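import Summits.ABC.ABC.Theses.PadicPrimesW80OddRadOne
import Summits.ABC.ABC.Theorems.PadicPrimesW80TwoThirdsW80ThreeModFour
import Summits.ABC.ABC.Theorems.PadicPrimesW80TwoThirdsW80OneModFour
import Summits.ABC.ABC.Theorems.PadicPrimesW80OddRadOneClosers
import HarnessLib

/-!
# Rung A1.M2⁻ by name: `EpsShapeBoundOne` (`log c ≤ κ_ε · rad(abc)^{1+ε}`) — UNCONDITIONAL

`Summits/ABC/ABC/Theorems/EpsShapeBoundOneHolds.lean` — cell `abc-stewartyu` (planner-staged template
HOME/plan/routes/closers/EpsShapeBoundOneHolds.lean; bytes p1-g5, filed by p3-g3 after the closer of stmt-ABC-19487).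
The four items of route `PadicPrimesW80OddRadOne` are landed theorems: `W80ThreeModFour` (p2-g2,
`padicPrimesW80TwoThirds_w80ThreeModFour_proof`), `W80OneModFour` (p3-g2's ± machine,
`padicPrimesW80TwoThirds_w80OneModFour_proof`), `FinFromW80Odd` and `OddKappaDoorSpec` (p3-g2); the route's
`closes` composes them into the rung leaf `Literature.Barriers.ABC.EpsShapeBoundOne`. [folklore] assembly.
-/

namespace Summit.ABC.ABC.Theorems

open Summit.ABC.ABC.Theses

/-- **Rung A1.M2⁻: `EpsShapeBoundOne` holds** — for every `ε > 0` there is `κ_ε` with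
`log c ≤ κ_ε · rad(abc)^{1+ε}` for all `abc`-triples (the leaf `Literature.Barriers.ABC.EpsShapeBoundOne`,
by the Waldschmidt-shape `p`-adic bounds at every odd prime and the odd κ-door). [folklore] -/
theorem epsShapeBoundOne_holds : Literature.Barriers.ABC.EpsShapeBoundOne :=
  PadicPrimesW80OddRadOne.closes padicPrimesW80TwoThirds_w80ThreeModFour_proof
    padicPrimesW80TwoThirds_w80OneModFour_proof
    padicPrimesW80OddRadOne_finFromW80Odd_proof padicPrimesW80OddRadOne_oddKappaDoorSpec_proof

end Summit.ABC.ABC.Theorems
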